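import Literature.MathematicalPhysics.QuantumFieldTheory.Balaban1983to89.B9Eq347GlobalFromLocalZd
import Literature.MathematicalPhysics.QuantumFieldTheory.Balaban1983to89.B9SupplySockB9P3ZdSrc

/-!
# `Balaban1983to89.B9Eq343HolderGlobalFromLocalZd` — [Balaban1985BackgroundPropagators] (3.43) p. 398 ∕ [Balaban1985RegularSpaces] (1.36) p. 82,
# (1.59)–(1.62) pp. 86–87 «‖A‖_{1,β} < 5dLB₀(β)(α₀+α₁)(Lʲη)^{−2−β} on Ω_j … B₀(β₀) are the corresponding norms of the operators G(U₀), H(U₀)»: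
# THE HÖLDER SUMMATION — the LOCAL Hölder inequality (3.43) «‖ζ∇_UG(U)λ‖_β, ‖ζG(U)∇*_Uλ‖_β ≤ B₀(β₀)(Lʲη)^{1−β}(‖ζ‖^ξ_β + |ζ|)e^{−δ₀d(y,y′)}|λ|,
# ζ ∈ C₀^∞(Δ̃(y)), y ∈ Λ_j, supp λ ⊂ Δ(y′)» AT THE GENUINE READINGS of `G(U₀)` on the `ℤᵈ × 𝔸` frame, summed over the source blocks with the two
# clauses of [Balaban1984PropagatorsII] Lemma 2.1 DISPLAYED, gives the GLOBAL weighted bound on every covariant Hölder quotient (3.40) of `ζ_y·∇_UG(U₀)J`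
# — the shape of the junction's Hölder binder `B9SupplySockB9P3ZdGammaUnivDelta.HolderAtδ` — for ANY cut-off family `ζ_y`; plus the cut-off removal on
# the pairs where `ζ_y = 1` and the FAR-PAIR half from the sup road

statement-level skeleton of published theorems with citation tags; proofs where landed; nothing here is a claim about the
Yang–Mills mass gap

PDF held: `paper:balaban1985-cmp99-background-propagators` ([4] = B9; journal page = PDF page + 388): p. 397 (3.40)–(3.41), p. 398 (3.43), (3.47) and
l. 17–20 «Using Lemma 2.1 in [4] we may replace the factor (Lʲη)^α by (Lʲη)^β(L^{j′}η)^γ … It is easy to see that the global inequalities (3.47) are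
consequences of the local ones (3.42) and Lemma 2.1» (page IMAGE re-read by this seat 2026-08-28: in (3.43) the cut-off norm is printed «‖ζ‖^ξ_β + |ζ|,
ξ = L^{−j}», i.e. on the ξ-SCALE — see LOCATED (L-H2)); `paper:balaban1985-cmp99-regular-spaces-gauge-fixing` (B8; journal page = PDF page + 74): p. 82
(1.36), p. 86 (1.59), p. 87 (1.62) + Prop. 3 (page images).  [Balaban1984PropagatorsII] p. 234 Lemma 2.1 (2.60)–(2.61) through leaf-03's audited header of
`B9Eq347GlobalFromLocal` — BY NAME.

WHY THIS FILE (cell `pub-ymgap`, HUMAN RULING D-0062 ∕ D-0149; seat `pub-ymgap-dag-n06-w2` (g2), node N06 = [B9]; INTENT-1; count-neutral).  The junction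
J-N06→N05 feeds B8 Prop. 3's Hölder line (1.36)∕(1.62) through the binder `HolderAt` ∕ `HolderAtδ` («local Hölder blocks of rate δ₀ ⟹ the global weighted
Hölder reading ≤ CH(δ₀)·Bβ(β)·|J|₍₋₃₎»), whose docstring names the supplier: «the summation itself (at pinned local letters …) is dag-n06-w2's file».  g0 of
this seat pinned the local letters to the operator (`locOfOpsZd`, p588432) and mechanised print's «easy to see» for the four SUP entries of (3.47)
(`B9Eq347GlobalFromLocalZd`, p589880).  THIS FILE is the Hölder twin: the (3.43) clause of `B9.Ineq343_345 (GAZdOfOps …)` read by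
`ineq343_h1_of_GAZdOfOps` is a statement about the covariant Hölder norm (3.40) of `ζ·∇_{U,ν}G(U)J` for EVERY cut-off `ζ` supported in `Δ̃(y)`; one summation
over the source blocks (leaf-03's `weight_mul_norm_apply_le_of_local` at the PAIR-INDEXED ℝ-linear map `J ↦ |x′−x|^{−β}(R(U(Γ_{x,x′}))(ζ_y∇_νGJ)_μ(x′) −
(ζ_y∇_νGJ)_μ(x))`, output block = the cut-off's block `y`) gives the global weighted bound; where `ζ_y(x) = ζ_y(x′) = 1` the cut-off drops out (near pairs);
pairs longer than a fixed fraction of `Lʲη` (far pairs) are bounded by the two endpoint values, i.e. by the n = 1 sup entry `|∇_UG(U)J|₍₋₂₎` of (3.47).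

WHAT IS PROVED (0 sorry; proof lane — no `def`; [folklore] finite sums + the tree's letters BY NAME).
* §1 pair bookkeeping on the (3.40) quotient `hquot`: `hquot_congr` (depends on the two values only), ★ `hquot_cutMulZd_of_eq_one` (CUT-OFF REMOVAL: `ζ(x) =
  ζ(x′) = 1 ⇒ hquot(ζ·Ψ)_μ(x,x′) = hquot(Ψ_μ)(x,x′)`), `hquot_eq_norm_smul` (the quotient IS the norm of the scaled transported difference), `hquot_zero_fun`,
  `hquot_le_norm_add_div` (unitary `U`: `hquot F (x,x′) ≤ (‖F x‖ + ‖F x′‖)∕|x−x′|^β`), `cutMulZd_eq_real_smul`, `cutHZd_nonneg`.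
* §2 THE READING, POINTWISE: ★ `hquot_cut_grad_le_h1OfOps` ∕ `hquot_cut_div_le_h1OfOps` — every `(ν, μ, admissible pair)` quotient of `ζ·∇_{U,ν}G(U)J` (resp.
  `ζ·G(U)∇*_{U,ν}J`) is `≤ h1OfOps … U J β ζ` for a FINITELY SUPPORTED `ζ` and a length function with `len ≥ 1` on admissible displacements (the real-`iSup`
  `holder0` is then a genuine supremum — `BddAbove` proved, not assumed); ★ `locHolder_grad_of_ineq343` ∕ `locHolder_div_of_ineq343` — the (3.43) clause READ as
  a pointwise local Hölder letter with block factor `a(y) = (Lʲη)^{1−β}·cutHZd η β len ζ_y` and constant `max{0, Bβ β}`.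
* §3 ★★ `weight_mul_hquot_cut_le_of_local` — THE GENERIC HÖLDER SUMMATION on a member with finitely many blocks: a displayed-ℝ-linear letter `Θ` on bond
  fields, a cut-off family `ζ : 𝔅 → (ℤᵈ → ℝ)`, a POINTWISE LOCAL HÖLDER LETTER for `Θ` with block factor `a` (displayed; §2 inhabits it from (3.43) for `Θ =
  ∇_{U,ν}∘G(U)` and `G(U)∘∇*_{U,ν}`), a bond class `P` with base-block assignment `π` (g0's shape), the EXCHANGE letter `ω′(u)·a(u) ≤ R·e^{κ₂d(u,v)}·ω(v)` ((2.60))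
  and the ROW letter `Σ_v e^{−(δ₀−κ₂)d(u,v)} ≤ S` ((2.61)) DISPLAYED ⟹ for every `f` on the class with `ω(π y)‖f(y)‖ ≤ M`, every block `u`, component `μ` and
  admissible pair `p`: `ω′(u)·hquot(ζ_u·Θf̃)_μ(p) ≤ B·R·S·M`.  ★★ `weight_mul_hquot_cut_gradGop_le_of_ineq343` ∕ `…_cut_gopDiv_…` (the two (3.43) members at the
  genuine readings) and ★★ `weight_mul_hquot_gradGop_le_of_ineq343` (NEAR PAIRS: `ζ_u = 1` at both points ⇒ the bare quotient of `∇_{U,ν}G(U)f̃`, the integrand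
  of `HolderAtδ`).
* §4 FAR PAIRS (letter level): `rpow_weight_far` (`c·t ≤ s ⇒ t^{2+β}∕s^β ≤ c^{−β}t²`), ★ `weight_mul_hquot_le_of_far` (`(Lʲη)^{2+β}·hquot F (x,x′) ≤
  c^{−β}·((Lʲη)²‖F x‖ + (Lʲη)²‖F x′‖)` when `|x−x′| ≥ c·Lʲη`), ★ `weight_mul_hquot_le_msup_of_far` (⟹ `≤ 2c^{−β}·|∇_UΨ|₍₋₂₎` when BOTH endpoints' bonds are sides
  of plaquettes touching `Ω_j` — the n = 1 entry of (3.47) ∕ B8 (1.59), `DictAt`'s `glob 1` reading).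
HONEST SCOPE + LOCATED (count-neutral; nothing of [4] Thm 3.1∕3.3 asserted; `G(U₀)` stays a letter; the local Hölder letter, the cut-off family, the block
assignment and both Lemma-2.1 letters are DISPLAYED).  (L-H1) «FIRST-POINT CLASS»: `HolderAt`∕`HolderAtδ` weigh a pair `(x,x′)` — ANY pair up to physical
distance 1, i.e. up to `η⁻¹` lattice steps — by `(Lʲη)^{2+β}` for every `j` with `x ∈ Ω_j` and no condition on `x′`; §4 bounds far pairs by `(Lʲη)²(‖∇GJ(x)‖ +
‖∇GJ(x′)‖)`, and `(Lʲη)²‖∇GJ(x′)‖ ≤ |∇GJ|₍₋₂₎` needs `x′`'s bond to touch `Ω_j` TOO (`weight_mul_hquot_le_msup_of_far`'s `hx'`): with `x′` at a finer level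
`j″ < j` (allowed at physical distance ≤ 1 once `RM·L^{j−1}η ≲ 1`) the reading (3.47) permits `‖∇GJ(x′)‖ = B₀(L^{j″}η)^{−2}|J|₍₋₃₎` and the weighted quotient
is `≈ B₀L^{2(j−j″)}|J|₍₋₃₎`, not member-uniform — print B8 (1.36) «on Ω_j» read with BOTH points in `Ω_j` is what §3–§4 supply.  (L-H2) «η-SCALE CUT-OFF NORM»:
print's (3.43) carries `‖ζ‖^ξ_β`, `ξ = L^{−j}` (O(1) for a cut-off living on `Δ̃(y)`); the frame's `cutHZd η β len ζ` is the η-scale norm, `≳ (Lʲη∕2)^{−β}` for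
any `ζ` supported in `Δ̃(y)` and `= 1` somewhere on `Δ(y)` — so the exchange letter of §3 with `a(u) = (L^{j_u}η)^{1−β}·cutHZd(ζ_u)` is inhabited on each finite
member (finitely many inequalities) but NOT with member-uniform `R`; the theorems here keep `a`, `R` DISPLAYED and are agnostic — they serve the typed reading
now and a ξ-scaled re-typing unchanged (companion `B9Eq343CutoffFamilyZd`: the canonical lattice cut-off and both bounds in kernel form).  The univ road
(infinitely many blocks) is not covered (as in g0's file).  Count-neutral; N05∕N06 NOT discharged; one finite lattice programme at fixed `ε`; R4 closes the
conditional finite-𝕋⁴ rung `BalabanLadder.UV` only; nothing continuum ∕ ℝ⁴ ∕ OS ∕ mass-gap ∕ Clay.  Unit `pub-ymgap-dag-n06-w2` (g2), 2026-08-28.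
-/

noncomputable section

namespace Literature.MathematicalPhysics.QuantumFieldTheory.Balaban1983to89.B9Eq343HolderGlobalFromLocalZd

open B7Prop1Local (InBox)
open B7Prop1Explicit (U1)
open B7Prop2Explicit (unitaryUnits unitaryUnits_le_U1)
open B7Eq78Linearization (conjR)
open B8Ineq132 (covDerivFwd covDeriv BondTouches)
open B8Eq140Level (SideTouches)
open B8ScaledSupNorm (msup weight Bdd weight_mul_norm_le_msup)
open B8LeafModelZd (ZdIdx)
open B9Eq340HolderZd (hquot AdmPair holder0 trans hquot_nonneg)
open B9SupplySockB9P3ZdLetters (OpsZd)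
open B9SupplySockB9P3ZdFrame (MemberZd BSite blockZd blockTZd CfgZd geoZd distZd supNormZd cutHZd cutSupZd)
open B9SupplySockB9P3ZdLocalLettersOfOps (cdBZd cdsBZd cutMulZd h1OfOps GAZdOfOps ineq343_h1_of_GAZdOfOps holder0_nonneg)
open B9SupplySockB9P3ZdSrc (trans_add)
open B9Eq347GlobalFromLocal (weight_mul_norm_apply_le_of_local)
open B9Eq347GlobalFromLocalZd (finite_inBox extZd extZd_apply_of extZd_apply_of_not extZd_add extZd_smul covDerivFwd_linear cdBZd_linear
  cdsBZd_linear comp_linear supNormZd_le_of_forall)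

-- `Site` alone could resolve to the torus sites of `Setup.lean`; re-export the `ℤ^d` sites of `B7Prop1Explicit`.
export B7Prop1Explicit (Site)

variable {d : ℕ}

/-! ## §1 Bookkeeping on the covariant Hölder quotient (3.40) -/

section Pair

variable {𝔸 : Type*} [NormedRing 𝔸] [NormedAlgebra ℂ 𝔸]

omit [NormedAlgebra ℂ 𝔸] in
/-- the quotient (3.40) at the pair `(x, x′)` depends on the two values `F(x)`, `F(x′)` only. [cite: Balaban1985BackgroundPropagators, (3.40) p.397] -/
theorem hquot_congr {η β : ℝ} {len : Site d → ℝ} (U₀ : Site d → Fin d → 𝔸ˣ) {F G : Site d → 𝔸} {p : Site d × Site d}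
    (h1 : F p.1 = G p.1) (h2 : F p.2 = G p.2) : hquot η β len U₀ F p = hquot η β len U₀ G p := by
  simp only [B9Eq340HolderZd.hquot_def, h1, h2]

/-- the cut-off «ζ·» of (3.43) is the REAL scalar action of `ζ(z)` (the frame spells it through `ℂ`). [cite: Balaban1985BackgroundPropagators, (3.43) p.398] -/
theorem cutMulZd_eq_real_smul (ζ : Site d → ℝ) (Ψ : Site d → Fin d → 𝔸) (z : Site d) (μ : Fin d) :
    cutMulZd ζ Ψ z μ = (ζ z) • Ψ z μ := by
  simp only [cutMulZd, Complex.coe_smul]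

/-- ★ **CUT-OFF REMOVAL**: where `ζ(x) = ζ(x′) = 1` the quotient of `ζ·Ψ` at `(x, x′)` is the quotient of `Ψ` (component `μ`) — print's use of (3.43) on the pairs
inside the region where the cut-off is `1`. [cite: Balaban1985BackgroundPropagators, (3.43) p.398, (3.40) p.397] -/
theorem hquot_cutMulZd_of_eq_one {η β : ℝ} {len : Site d → ℝ} (U₀ : Site d → Fin d → 𝔸ˣ) (ζ : Site d → ℝ) (Ψ : Site d → Fin d → 𝔸)
    (μ : Fin d) {p : Site d × Site d} (h1 : ζ p.1 = 1) (h2 : ζ p.2 = 1) :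
    hquot η β len U₀ (fun z => cutMulZd ζ Ψ z μ) p = hquot η β len U₀ (fun z => Ψ z μ) p :=
  hquot_congr U₀ (by simp [cutMulZd_eq_real_smul, h1]) (by simp [cutMulZd_eq_real_smul, h2])

/-- ★ **THE QUOTIENT IS A NORM**: on an admissible pair (`η > 0`), `hquot F (x,x′) = ‖|x′−x|^{−β}·(R(U(Γ_{x,x′}))F(x′) − F(x))‖` — the scaled transported
difference, ℝ-LINEAR in `F`, through which leaf-03's summation for linear maps applies to Hölder quotients. [cite: Balaban1985BackgroundPropagators, (3.40) p.397] -/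
theorem hquot_eq_norm_smul {η β : ℝ} (hη : 0 < η) {len : Site d → ℝ} (U₀ : Site d → Fin d → 𝔸ˣ) (F : Site d → 𝔸)
    {p : Site d × Site d} (hp : p ∈ AdmPair η len) :
    hquot η β len U₀ F p = ‖((η * len (p.2 - p.1)) ^ β)⁻¹ • (trans U₀ p.1 p.2 (F p.2) - F p.1)‖ := by
  have hpos : 0 < (η * len (p.2 - p.1)) ^ β := Real.rpow_pos_of_pos (mul_pos hη hp.1) β
  rw [norm_smul, norm_inv, Real.norm_of_nonneg hpos.le, B9Eq340HolderZd.hquot_def, div_eq_inv_mul]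

omit [NormedAlgebra ℂ 𝔸] in
/-- the quotient of the zero function vanishes. [cite: Balaban1985BackgroundPropagators, (3.40) p.397 (bookkeeping)] -/
theorem hquot_zero_fun (η β : ℝ) (len : Site d → ℝ) (U₀ : Site d → Fin d → 𝔸ˣ) (p : Site d × Site d) :
    hquot η β len U₀ (fun _ => (0 : 𝔸)) p = 0 := by
  simp [B9Eq340HolderZd.hquot_def, B9Eq340HolderZd.trans_def, B7Eq78Linearization.conjR_apply]

omit [NormedAlgebra ℂ 𝔸] in
/-- **the two-endpoint bound**: for a `U1`-valued (e.g. unitary) background the transport is an isometry, so `hquot F (x,x′) ≤ (‖F x‖ + ‖F x′‖)∕|x′−x|^β` — the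
far-pair road to the sup entries. [cite: Balaban1985BackgroundPropagators, (3.40) p.397, (3.42) n = 1 p.397] -/
theorem hquot_le_norm_add_div [NormOneClass 𝔸] {η β : ℝ} (hη : 0 ≤ η) {len : Site d → ℝ} {U₀ : Site d → Fin d → 𝔸ˣ}
    (hU₀ : ∀ y κ, U₀ y κ ∈ U1 𝔸) (F : Site d → 𝔸) {p : Site d × Site d} (hp : p ∈ AdmPair η len) :
    hquot η β len U₀ F p ≤ (‖F p.1‖ + ‖F p.2‖) / (η * len (p.2 - p.1)) ^ β := by
  rw [B9Eq340HolderZd.hquot_def]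
  refine div_le_div_of_nonneg_right ?_ (Real.rpow_nonneg (mul_nonneg hη hp.1.le) β)
  calc ‖trans U₀ p.1 p.2 (F p.2) - F p.1‖ ≤ ‖trans U₀ p.1 p.2 (F p.2)‖ + ‖F p.1‖ := norm_sub_le _ _
    _ = ‖F p.2‖ + ‖F p.1‖ := by rw [B9Eq340HolderZd.norm_trans hU₀]
    _ = ‖F p.1‖ + ‖F p.2‖ := add_comm _ _

omit [NormedRing 𝔸] [NormedAlgebra ℂ 𝔸] in
/-- `‖ζ‖_β + |ζ| ≥ 0` (both summands are real `iSup`s of non-negative families). [cite: Balaban1985BackgroundPropagators, (3.43) p.398 (bookkeeping)] -/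
theorem cutHZd_nonneg {η : ℝ} (hη : 0 ≤ η) (β : ℝ) (len : Site d → ℝ) (ζ : Site d → ℝ) : 0 ≤ cutHZd η β len ζ := by
  refine add_nonneg (Real.iSup_nonneg fun p => ?_) (Real.iSup_nonneg fun z => abs_nonneg _)
  exact div_nonneg (abs_nonneg _) (Real.rpow_nonneg (mul_nonneg hη p.2.1.le) β)

end Pair

/-! ## §2 The (3.43) reading, pointwise: every quotient of `ζ·∇_{U,ν}G(U)J` is below `h1OfOps`, and the local Hölder letter it yields -/

section Reading

variable {𝔸 : Type} [CStarAlgebra 𝔸] [Nontrivial 𝔸] {L : ℕ} {len : Site d → ℝ}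

/-- a cut-off supported in `Δ̃(y)` is finitely supported. [cite: Balaban1985BackgroundPropagators, p.397 («Δ̃(y) is a cube of the size 2Lʲη»)] -/
theorem finite_support_of_cutInT {j : ℕ} {y : Site d} {ζ : Site d → ℝ} (hζ : ∀ z, ζ z ≠ 0 → z ∈ blockTZd L j y) :
    Set.Finite {z : Site d | ζ z ≠ 0} :=
  (finite_inBox _ _).subset fun z hz => hζ z hz

omit [Nontrivial 𝔸] in
/-- **the cut-off field is uniformly bounded**: for a finitely supported `ζ`, `‖(ζ·Ψ)_μ(z)‖ ≤ C` for one `C ≥ 0`, all `z`, `μ`.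
[cite: Balaban1985BackgroundPropagators, (3.43) p.398 (bookkeeping)] -/
theorem exists_bound_cutMulZd {ζ : Site d → ℝ} (hfin : Set.Finite {z : Site d | ζ z ≠ 0}) (Ψ : Site d → Fin d → 𝔸) :
    ∃ C : ℝ, 0 ≤ C ∧ ∀ (z : Site d) (μ : Fin d), ‖cutMulZd ζ Ψ z μ‖ ≤ C := by
  classical
  have hfin' : Set.Finite ((fun q : Site d × Fin d => ‖cutMulZd ζ Ψ q.1 q.2‖) '' ({z : Site d | ζ z ≠ 0} ×ˢ (Set.univ : Set (Fin d)))) :=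
    (hfin.prod Set.finite_univ).image _
  obtain ⟨C, hC⟩ := hfin'.bddAbove
  refine ⟨max C 0, le_max_right _ _, fun z μ => ?_⟩
  by_cases hz : ζ z ≠ 0
  · exact (hC ⟨(z, μ), ⟨hz, Set.mem_univ _⟩, rfl⟩).trans (le_max_left _ _)
  · rw [not_not] at hz
    simp [cutMulZd, hz]

/-- **every quotient of a finitely supported cut-off field is uniformly bounded** (unitary background, `len ≥ 1` on admissible displacements): the side
condition under which the real `iSup` in `holder0` is print's supremum. [cite: Balaban1985BackgroundPropagators, (3.40) p.397, (3.43) p.398 (bookkeeping)] -/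
theorem bddAbove_hquot_cutMulZd {x : MemberZd d L} (U : CfgZd d 𝔸) (β : ℝ) (hβ0 : 0 ≤ β)
    (hlen : ∀ v : Site d, 0 < len v → 1 ≤ len v) {ζ : Site d → ℝ} (hfin : Set.Finite {z : Site d | ζ z ≠ 0})
    (Ψ : Site d → Fin d → 𝔸) :
    BddAbove (Set.range fun q : Fin d × AdmPair x.i.η len => hquot x.i.η β len U.1 (fun z => cutMulZd ζ Ψ z q.1) q.2.1) := by
  have hη : 0 < x.i.η := x.i.hη
  have hU1 : ∀ y κ, U.1 y κ ∈ U1 𝔸 := fun y κ => unitaryUnits_le_U1 (U.2 y κ)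
  obtain ⟨C, hC0, hC⟩ := exists_bound_cutMulZd hfin Ψ
  refine ⟨(C + C) / x.i.η ^ β, ?_⟩
  rintro _ ⟨q, rfl⟩
  have hq : (q.2 : Site d × Site d) ∈ AdmPair x.i.η len := q.2.2
  have hD : x.i.η ^ β ≤ (x.i.η * len (q.2.1.2 - q.2.1.1)) ^ β := by
    refine Real.rpow_le_rpow hη.le ?_ hβ0
    have h1 := hlen _ hq.1
    nlinarith
  have hDpos : 0 < x.i.η ^ β := Real.rpow_pos_of_pos hη β
  calc hquot x.i.η β len U.1 (fun z => cutMulZd ζ Ψ z q.1) q.2.1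
      ≤ (‖cutMulZd ζ Ψ q.2.1.1 q.1‖ + ‖cutMulZd ζ Ψ q.2.1.2 q.1‖) / (x.i.η * len (q.2.1.2 - q.2.1.1)) ^ β :=
        hquot_le_norm_add_div hη.le hU1 _ hq
    _ ≤ (C + C) / (x.i.η * len (q.2.1.2 - q.2.1.1)) ^ β :=
        div_le_div_of_nonneg_right (add_le_add (hC _ _) (hC _ _)) (hDpos.le.trans hD)
    _ ≤ (C + C) / x.i.η ^ β := div_le_div_of_nonneg_left (add_nonneg hC0 hC0) hDpos hD

/-- ★ **EVERY QUOTIENT OF `ζ·∇_{U,ν}G(U)J` IS BELOW THE (3.43) READING**: for a finitely supported `ζ`, `0 ≤ β`, `len ≥ 1` on admissible displacements,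
`hquot(ζ·∇_{U,ν}G(U)J)_μ(p) ≤ h1OfOps … U J β ζ` at every `(ν, μ, p)`. [cite: Balaban1985BackgroundPropagators, (3.43) p.398, (3.40) p.397] -/
theorem hquot_cut_grad_le_h1OfOps {x : MemberZd d L} (ops : OpsZd d 𝔸) (U : CfgZd d 𝔸) (J : Site d → Fin d → 𝔸) {β : ℝ} (hβ0 : 0 ≤ β)
    (hlen : ∀ v : Site d, 0 < len v → 1 ≤ len v) {ζ : Site d → ℝ} (hfin : Set.Finite {z : Site d | ζ z ≠ 0})
    (ν μ : Fin d) {p : Site d × Site d} (hp : p ∈ AdmPair x.i.η len) :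
    hquot x.i.η β len U.1 (fun z => cutMulZd ζ (cdBZd x.i.η U.1 ν (ops.Gop U.1 J)) z μ) p ≤ h1OfOps 𝔸 L len ops x U J β ζ := by
  have h1 : hquot x.i.η β len U.1 (fun z => cutMulZd ζ (cdBZd x.i.η U.1 ν (ops.Gop U.1 J)) z μ) p ≤
      holder0 x.i.η β len U.1 (cutMulZd ζ (cdBZd x.i.η U.1 ν (ops.Gop U.1 J))) :=
    le_ciSup (bddAbove_hquot_cutMulZd U β hβ0 hlen hfin _) (μ, ⟨p, hp⟩)
  have h2 : holder0 x.i.η β len U.1 (cutMulZd ζ (cdBZd x.i.η U.1 ν (ops.Gop U.1 J))) ≤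
      ⨆ ν' : Fin d, holder0 x.i.η β len U.1 (cutMulZd ζ (cdBZd x.i.η U.1 ν' (ops.Gop U.1 J))) :=
    le_ciSup (f := fun ν' : Fin d => holder0 x.i.η β len U.1 (cutMulZd ζ (cdBZd x.i.η U.1 ν' (ops.Gop U.1 J))))
      (Set.finite_range _).bddAbove ν
  exact h1.trans (h2.trans (le_max_left _ _))

/-- ★ the same for the second member of (3.43), `ζ·G(U)∇*_{U,ν}J`. [cite: Balaban1985BackgroundPropagators, (3.43) p.398, (3.40) p.397] -/
theorem hquot_cut_div_le_h1OfOps {x : MemberZd d L} (ops : OpsZd d 𝔸) (U : CfgZd d 𝔸) (J : Site d → Fin d → 𝔸) {β : ℝ} (hβ0 : 0 ≤ β)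
    (hlen : ∀ v : Site d, 0 < len v → 1 ≤ len v) {ζ : Site d → ℝ} (hfin : Set.Finite {z : Site d | ζ z ≠ 0})
    (ν μ : Fin d) {p : Site d × Site d} (hp : p ∈ AdmPair x.i.η len) :
    hquot x.i.η β len U.1 (fun z => cutMulZd ζ (ops.Gop U.1 (cdsBZd x.i.η U.1 ν J)) z μ) p ≤ h1OfOps 𝔸 L len ops x U J β ζ := by
  have h1 : hquot x.i.η β len U.1 (fun z => cutMulZd ζ (ops.Gop U.1 (cdsBZd x.i.η U.1 ν J)) z μ) p ≤
      holder0 x.i.η β len U.1 (cutMulZd ζ (ops.Gop U.1 (cdsBZd x.i.η U.1 ν J))) :=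
    le_ciSup (bddAbove_hquot_cutMulZd U β hβ0 hlen hfin _) (μ, ⟨p, hp⟩)
  have h2 : holder0 x.i.η β len U.1 (cutMulZd ζ (ops.Gop U.1 (cdsBZd x.i.η U.1 ν J))) ≤
      ⨆ ν' : Fin d, holder0 x.i.η β len U.1 (cutMulZd ζ (ops.Gop U.1 (cdsBZd x.i.η U.1 ν' J))) :=
    le_ciSup (f := fun ν' : Fin d => holder0 x.i.η β len U.1 (cutMulZd ζ (ops.Gop U.1 (cdsBZd x.i.η U.1 ν' J))))
      (Set.finite_range _).bddAbove ν
  exact h1.trans (h2.trans (le_max_right _ _))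

/-- ★ **THE (3.43) CLAUSE READ AS A POINTWISE LOCAL HÖLDER LETTER FOR `∇_{U,ν}∘G(U)`**: for a cut-off FAMILY `ζ_u` supported in `Δ̃(u)` and `J` supported on the
bonds of `Δ(v)`, every quotient of `ζ_u·∇_{U,ν}G(U)J` is `≤ max{0, Bβ β}·(L^{j_u}η)^{1−β}·cutHZd(ζ_u)·e^{−δ₀d(u,v)}·|J|` — the shape §3 sums.
[cite: Balaban1985BackgroundPropagators, (3.43) p.398, Thm 3.3 p.399] -/
theorem locHolder_grad_of_ineq343 {x : MemberZd d L} {ops : OpsZd d 𝔸} {U : CfgZd d 𝔸} {Bβ Bε : ℝ → ℝ} {Bεβ : ℝ → ℝ → ℝ}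
    {δ₀ β : ℝ} (h345 : B9.Ineq343_345 (GAZdOfOps 𝔸 L len x ops) Bβ Bε Bεβ δ₀ U) (hβ0 : 0 ≤ β) (hβ1 : β < 1)
    (hlen : ∀ v : Site d, 0 < len v → 1 ≤ len v) (ζ : BSite L x → Site d → ℝ)
    (hζ : ∀ (u : BSite L x) (z : Site d), ζ u z ≠ 0 → z ∈ blockTZd L u.1.1 u.1.2) (ν : Fin d)
    (u v : BSite L x) (J : Site d → Fin d → 𝔸) (hJ : ∀ (z : Site d) (μ : Fin d), J z μ ≠ 0 → BondTouches (blockZd L v.1.1 v.1.2) z μ)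
    (μ : Fin d) (p : Site d × Site d) (hp : p ∈ AdmPair x.i.η len) :
    hquot x.i.η β len U.1 (fun z => cutMulZd (ζ u) (cdBZd x.i.η U.1 ν (ops.Gop U.1 J)) z μ) p ≤
      max 0 (Bβ β) * (((L : ℝ) ^ u.1.1 * x.i.η) ^ (1 - β) * cutHZd x.i.η β len (ζ u)) *
        Real.exp (-(δ₀ * distZd L x u v)) * supNormZd J := by
  have h1 := hquot_cut_grad_le_h1OfOps ops U J hβ0 hlen (finite_support_of_cutInT (hζ u)) ν μ hp
  have h2 := ineq343_h1_of_GAZdOfOps (𝔸 := 𝔸) (L := L) (len := len) h345 β J (ζ u) u v hβ0 hβ1 (hζ u) hJ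
  have hs : 0 ≤ ((L : ℝ) ^ u.1.1 * x.i.η) ^ (1 - β) := Real.rpow_nonneg (by have := x.i.hη.le; positivity) _
  have hc : 0 ≤ cutHZd x.i.η β len (ζ u) := cutHZd_nonneg x.i.hη.le β len (ζ u)
  have hn : 0 ≤ supNormZd J := Real.iSup_nonneg fun _ => norm_nonneg _
  have h3 : Bβ β * ((L : ℝ) ^ u.1.1 * x.i.η) ^ (1 - β) * cutHZd x.i.η β len (ζ u) * Real.exp (-(δ₀ * distZd L x u v)) * supNormZd J ≤
      max 0 (Bβ β) * (((L : ℝ) ^ u.1.1 * x.i.η) ^ (1 - β) * cutHZd x.i.η β len (ζ u)) * Real.exp (-(δ₀ * distZd L x u v)) * supNormZd J := by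
    have := mul_le_mul_of_nonneg_right (le_max_right 0 (Bβ β))
      (mul_nonneg (mul_nonneg (mul_nonneg hs hc) (Real.exp_nonneg (-(δ₀ * distZd L x u v)))) hn)
    calc _ = Bβ β * (((L : ℝ) ^ u.1.1 * x.i.η) ^ (1 - β) * cutHZd x.i.η β len (ζ u) * Real.exp (-(δ₀ * distZd L x u v)) * supNormZd J) := by ring
      _ ≤ max 0 (Bβ β) * (((L : ℝ) ^ u.1.1 * x.i.η) ^ (1 - β) * cutHZd x.i.η β len (ζ u) * Real.exp (-(δ₀ * distZd L x u v)) * supNormZd J) := this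
      _ = _ := by ring
  exact h1.trans (h2.trans h3)

/-- ★ the same letter for the second member `G(U)∘∇*_{U,ν}`. [cite: Balaban1985BackgroundPropagators, (3.43) p.398, Thm 3.3 p.399] -/
theorem locHolder_div_of_ineq343 {x : MemberZd d L} {ops : OpsZd d 𝔸} {U : CfgZd d 𝔸} {Bβ Bε : ℝ → ℝ} {Bεβ : ℝ → ℝ → ℝ}
    {δ₀ β : ℝ} (h345 : B9.Ineq343_345 (GAZdOfOps 𝔸 L len x ops) Bβ Bε Bεβ δ₀ U) (hβ0 : 0 ≤ β) (hβ1 : β < 1)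
    (hlen : ∀ v : Site d, 0 < len v → 1 ≤ len v) (ζ : BSite L x → Site d → ℝ)
    (hζ : ∀ (u : BSite L x) (z : Site d), ζ u z ≠ 0 → z ∈ blockTZd L u.1.1 u.1.2) (ν : Fin d)
    (u v : BSite L x) (J : Site d → Fin d → 𝔸) (hJ : ∀ (z : Site d) (μ : Fin d), J z μ ≠ 0 → BondTouches (blockZd L v.1.1 v.1.2) z μ)
    (μ : Fin d) (p : Site d × Site d) (hp : p ∈ AdmPair x.i.η len) :
    hquot x.i.η β len U.1 (fun z => cutMulZd (ζ u) (ops.Gop U.1 (cdsBZd x.i.η U.1 ν J)) z μ) p ≤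
      max 0 (Bβ β) * (((L : ℝ) ^ u.1.1 * x.i.η) ^ (1 - β) * cutHZd x.i.η β len (ζ u)) *
        Real.exp (-(δ₀ * distZd L x u v)) * supNormZd J := by
  have h1 := hquot_cut_div_le_h1OfOps ops U J hβ0 hlen (finite_support_of_cutInT (hζ u)) ν μ hp
  have h2 := ineq343_h1_of_GAZdOfOps (𝔸 := 𝔸) (L := L) (len := len) h345 β J (ζ u) u v hβ0 hβ1 (hζ u) hJ
  have hs : 0 ≤ ((L : ℝ) ^ u.1.1 * x.i.η) ^ (1 - β) := Real.rpow_nonneg (by have := x.i.hη.le; positivity) _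
  have hc : 0 ≤ cutHZd x.i.η β len (ζ u) := cutHZd_nonneg x.i.hη.le β len (ζ u)
  have hn : 0 ≤ supNormZd J := Real.iSup_nonneg fun _ => norm_nonneg _
  have h3 : Bβ β * ((L : ℝ) ^ u.1.1 * x.i.η) ^ (1 - β) * cutHZd x.i.η β len (ζ u) * Real.exp (-(δ₀ * distZd L x u v)) * supNormZd J ≤
      max 0 (Bβ β) * (((L : ℝ) ^ u.1.1 * x.i.η) ^ (1 - β) * cutHZd x.i.η β len (ζ u)) * Real.exp (-(δ₀ * distZd L x u v)) * supNormZd J := by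
    have := mul_le_mul_of_nonneg_right (le_max_right 0 (Bβ β))
      (mul_nonneg (mul_nonneg (mul_nonneg hs hc) (Real.exp_nonneg (-(δ₀ * distZd L x u v)))) hn)
    calc _ = Bβ β * (((L : ℝ) ^ u.1.1 * x.i.η) ^ (1 - β) * cutHZd x.i.η β len (ζ u) * Real.exp (-(δ₀ * distZd L x u v)) * supNormZd J) := by ring
      _ ≤ max 0 (Bβ β) * (((L : ℝ) ^ u.1.1 * x.i.η) ^ (1 - β) * cutHZd x.i.η β len (ζ u) * Real.exp (-(δ₀ * distZd L x u v)) * supNormZd J) := this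
      _ = _ := by ring
  exact h1.trans (h2.trans h3)

end Reading

/-! ## §3 The generic Hölder summation and its instances at the genuine readings -/

section Main

variable {𝔸 : Type} [CStarAlgebra 𝔸] {L : ℕ} {len : Site d → ℝ}

/-- the cut-off field of an ℝ-linear combination. [cite: Balaban1985BackgroundPropagators, (3.43) p.398 (bookkeeping)] -/
theorem cutMulZd_linear (ζ : Site d → ℝ) (c : ℝ) (A B : Site d → Fin d → 𝔸) :
    cutMulZd ζ (c • A + B) = c • cutMulZd ζ A + cutMulZd ζ B := by
  funext z μ
  simp only [cutMulZd_eq_real_smul, Pi.add_apply, Pi.smul_apply, smul_add, smul_comm (ζ z) c]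

-- budget line: one `LinearMap` literal with two `funext`-proofs and a blockwise summation; elaborates inside the default today, margin for Mathlib drift
set_option maxHeartbeats 400000 in
/-- ★★ **THE GENERIC HÖLDER SUMMATION (local Hölder letter ⟹ global weighted Hölder bound)**, on a member with finitely many blocks.  Data: a
displayed-ℝ-linear letter `Θ` on bond fields; a cut-off family `ζ : 𝔅 → (ℤᵈ → ℝ)`; a POINTWISE LOCAL HÖLDER LETTER for `Θ` — for every output block `u`,
source block `v`, `J` supported on the bonds of `Δ(v)`, component `μ`, admissible pair `p`: `hquot(ζ_u·ΘJ)_μ(p) ≤ B·a(u)·e^{−δ₀d(u,v)}·|J|` (the shape of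
(3.43), `a(u) = (L^{j_u}η)^{1−β}(‖ζ_u‖ + |ζ_u|)`; inhabited from the reading by `locHolder_grad_of_ineq343` ∕ `locHolder_div_of_ineq343`); a bond class `P`
with base-block assignment `π` (`hπ`); the EXCHANGE letter `ω′(u)·a(u) ≤ R·e^{κ₂d(u,v)}·ω(v)` ([4] Lemma 2.1 (2.60)'s use) and the ROW letter
`Σ_v e^{−(δ₀−κ₂)d(u,v)} ≤ S` ((2.61)) DISPLAYED.  Conclusion: for every `f` on the class with `ω(π y)·‖f(y)‖ ≤ M`, every block `u`, component `μ`, admissible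
pair `p`: `ω′(u)·hquot(ζ_u·Θf̃)_μ(p) ≤ B·R·S·M` (`f̃ = extZd P f`).  Proof: leaf-03's `weight_mul_norm_apply_le_of_local` at the ℝ-linear map
`g ↦ ((u, μ, p) ↦ |p|^{−β}·(R(U(Γ_p))(ζ_uΘg̃)_μ(p₂) − (ζ_uΘg̃)_μ(p₁)))`, whose values have norm `hquot` (`hquot_eq_norm_smul`), output block map `(u, μ, p) ↦ u`.
[cite: Balaban1985BackgroundPropagators, (3.43) p.398 + p.398 l.17–20, (3.40) p.397; Balaban1984PropagatorsII, Lemma 2.1 (2.60)–(2.61) p.234; Balaban1985RegularSpaces, (1.36) p.82, (1.62) p.87] -/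
theorem weight_mul_hquot_cut_le_of_local {x : MemberZd d L} [Fintype (BSite L x)] (U : CfgZd d 𝔸) (β : ℝ)
    (Θ : (Site d → Fin d → 𝔸) → (Site d → Fin d → 𝔸))
    (hΘ : ∀ (c : ℝ) (A B : Site d → Fin d → 𝔸), Θ (c • A + B) = c • Θ A + Θ B)
    (ζ : BSite L x → Site d → ℝ) {B δ₀ : ℝ} (hB : 0 ≤ B) {a : BSite L x → ℝ} (ha : ∀ u, 0 ≤ a u)
    (hloc : ∀ (u v : BSite L x) (J : Site d → Fin d → 𝔸),
      (∀ (z : Site d) (μ : Fin d), J z μ ≠ 0 → BondTouches (blockZd L v.1.1 v.1.2) z μ) →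
      ∀ (μ : Fin d) (p : Site d × Site d), p ∈ AdmPair x.i.η len →
        hquot x.i.η β len U.1 (fun z => cutMulZd (ζ u) (Θ J) z μ) p ≤ B * a u * Real.exp (-(δ₀ * distZd L x u v)) * supNormZd J)
    {P : Site d × Fin d → Prop} (π : {b : Site d × Fin d // P b} → BSite L x)
    (hπ : ∀ b, b.1.1 ∈ blockZd L (π b).1.1 (π b).1.2)
    {κ₂ R S : ℝ} (hR : 0 ≤ R) {ω ω' : BSite L x → ℝ} (hω : ∀ v, 0 < ω v) (hω' : ∀ u, 0 ≤ ω' u)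
    (hex : ∀ u v : BSite L x, ω' u * a u ≤ R * Real.exp (κ₂ * distZd L x u v) * ω v)
    (hS : ∀ u : BSite L x, ∑ v, Real.exp (-((δ₀ - κ₂) * distZd L x u v)) ≤ S)
    (f : {b : Site d × Fin d // P b} → 𝔸) {M : ℝ} (hM : 0 ≤ M) (hMf : ∀ y, ω (π y) * ‖f y‖ ≤ M)
    (u : BSite L x) (μ : Fin d) {p : Site d × Site d} (hp : p ∈ AdmPair x.i.η len) :
    ω' u * hquot x.i.η β len U.1 (fun z => cutMulZd (ζ u) (Θ (extZd P f)) z μ) p ≤ B * R * S * M := by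
  have hη : 0 < x.i.η := x.i.hη
  -- `Θ 0 = 0` from the displayed linearity
  have hΘ0 : Θ (0 : Site d → Fin d → 𝔸) = 0 := by
    have h1 := hΘ 1 (0 : Site d → Fin d → 𝔸) 0
    rw [one_smul, one_smul, add_zero] at h1
    have : Θ 0 + Θ 0 = Θ 0 + 0 := by rw [add_zero]; exact h1.symm
    exact add_left_cancel this
  have hS0 : 0 ≤ S := (Finset.sum_nonneg fun v _ => Real.exp_nonneg _).trans (hS u)
  -- the empty class: everything vanishes
  rcases isEmpty_or_nonempty {b : Site d × Fin d // P b} with hP | hP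
  · have hext : extZd P f = 0 := by
      funext z ν
      by_cases h : P (z, ν)
      · exact (hP.false ⟨(z, ν), h⟩).elim
      · exact extZd_apply_of_not f h
    have hq : hquot x.i.η β len U.1 (fun z => cutMulZd (ζ u) (Θ (extZd P f)) z μ) p = 0 := by
      rw [hext, hΘ0]
      simp only [cutMulZd, Pi.zero_apply, smul_zero]
      exact hquot_zero_fun _ _ _ _ _
    rw [hq, mul_zero]
    exact mul_nonneg (mul_nonneg (mul_nonneg hB hR) hS0) hM
  -- the pair-indexed ℝ-linear map `g ↦ (scaled transported differences of ζ_u·Θg̃)`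
  let Φ : ({b : Site d × Fin d // P b} → 𝔸) → BSite L x → Fin d → Site d → 𝔸 :=
    fun g u' μ' z => cutMulZd (ζ u') (Θ (extZd P g)) z μ'
  have hΦ : ∀ (c : ℝ) (g g' : {b : Site d × Fin d // P b} → 𝔸) (u' : BSite L x) (μ' : Fin d) (z : Site d),
      Φ (c • g + g') u' μ' z = c • Φ g u' μ' z + Φ g' u' μ' z := by
    intro c g g' u' μ' z
    simp only [Φ]
    rw [extZd_add, extZd_smul, hΘ, cutMulZd_linear]
    rfl
  let T : ({b : Site d × Fin d // P b} → 𝔸) →ₗ[ℝ] (BSite L x × Fin d × AdmPair x.i.η len → 𝔸) :=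
    { toFun := fun g q => ((x.i.η * len (q.2.2.1.2 - q.2.2.1.1)) ^ β)⁻¹ •
        (trans U.1 q.2.2.1.1 q.2.2.1.2 (Φ g q.1 q.2.1 q.2.2.1.2) - Φ g q.1 q.2.1 q.2.2.1.1)
      map_add' := fun g g' => by
        funext q
        have h := hΦ 1 g g' q.1 q.2.1
        simp only [one_smul] at h
        simp only [Pi.add_apply, h, trans_add, smul_add, smul_sub]
        abel
      map_smul' := fun c g => by
        funext q
        have h := hΦ c g 0 q.1 q.2.1
        have h0 : ∀ z, Φ 0 q.1 q.2.1 z = 0 := fun z => by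
          simp only [Φ]
          have he : extZd P (0 : {b : Site d × Fin d // P b} → 𝔸) = 0 := by
            have := extZd_smul P (0 : ℝ) (0 : {b : Site d × Fin d // P b} → 𝔸)
            simpa using this
          rw [he, hΘ0]
          simp [cutMulZd]
        simp only [add_zero, h0] at h
        simp only [Pi.smul_apply, RingHom.id_apply, h, B9Eq340HolderZd.trans_smul, ← smul_sub, smul_comm c] }
  have hT : ∀ (g : {b : Site d × Fin d // P b} → 𝔸) (q : BSite L x × Fin d × AdmPair x.i.η len),
      ‖T g q‖ = hquot x.i.η β len U.1 (fun z => cutMulZd (ζ q.1) (Θ (extZd P g)) z q.2.1) q.2.2.1 := by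
    intro g q
    rw [hquot_eq_norm_smul hη U.1 _ q.2.2.2]
    rfl
  -- the local letter for `T`, output block map `q ↦ q.1`
  have hloc' : ∀ (v : BSite L x) (g : {b : Site d × Fin d // P b} → 𝔸) (F : ℝ), (∀ y, π y ≠ v → g y = 0) → (∀ y, ‖g y‖ ≤ F) →
      ∀ q : BSite L x × Fin d × AdmPair x.i.η len,
        ‖T g q‖ ≤ B * a q.1 * Real.exp (-(δ₀ * distZd L x q.1 v)) * F := by
    intro v g F hgv hgF q
    obtain ⟨b₀⟩ := hP
    have hF0 : 0 ≤ F := (norm_nonneg _).trans (hgF b₀)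
    have hsupp : ∀ (z : Site d) (ν : Fin d), extZd P g z ν ≠ 0 → BondTouches (blockZd L v.1.1 v.1.2) z ν := by
      intro z ν hne
      classical
      by_cases hPz : P (z, ν)
      · have hy : π ⟨(z, ν), hPz⟩ = v := by
          by_contra hne'
          exact hne (by rw [show extZd P g z ν = g ⟨(z, ν), hPz⟩ from extZd_apply_of g ⟨(z, ν), hPz⟩, hgv _ hne'])
        have hmem := hπ ⟨(z, ν), hPz⟩
        rw [hy] at hmem
        exact Or.inl hmem
      · exact absurd (extZd_apply_of_not g hPz) hne
    have h3 : supNormZd (extZd P g) ≤ F := by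
      refine supNormZd_le_of_forall hF0 fun z ν => ?_
      classical
      by_cases hPz : P (z, ν)
      · rw [show extZd P g z ν = g ⟨(z, ν), hPz⟩ from extZd_apply_of g ⟨(z, ν), hPz⟩]; exact hgF _
      · rw [extZd_apply_of_not g hPz, norm_zero]; exact hF0
    have h1 := hloc q.1 v (extZd P g) hsupp q.2.1 q.2.2.1 q.2.2.2
    have h4 : 0 ≤ B * a q.1 * Real.exp (-(δ₀ * distZd L x q.1 v)) := mul_nonneg (mul_nonneg hB (ha q.1)) (Real.exp_nonneg _)
    rw [hT]
    calc hquot x.i.η β len U.1 (fun z => cutMulZd (ζ q.1) (Θ (extZd P g)) z q.2.1) q.2.2.1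
        ≤ B * a q.1 * Real.exp (-(δ₀ * distZd L x q.1 v)) * supNormZd (extZd P g) := h1
      _ ≤ B * a q.1 * Real.exp (-(δ₀ * distZd L x q.1 v)) * F := mul_le_mul_of_nonneg_left h3 h4
  have h := weight_mul_norm_apply_le_of_local π (fun q : BSite L x × Fin d × AdmPair x.i.η len => q.1) (distZd L x) T
    (κ := δ₀) (κ₂ := κ₂) (a := a) hB hR hω hω' hloc' hex hS f hM hMf (u, μ, ⟨p, hp⟩)
  rw [hT] at h
  exact h

variable [Nontrivial 𝔸]

/-- the block factor of the (3.43) reading is non-negative. [cite: Balaban1985BackgroundPropagators, (3.43) p.398 (bookkeeping)] -/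
theorem blockFactor_nonneg (x : MemberZd d L) (β : ℝ) (ζ : BSite L x → Site d → ℝ) (u : BSite L x) :
    0 ≤ ((L : ℝ) ^ u.1.1 * x.i.η) ^ (1 - β) * cutHZd x.i.η β len (ζ u) :=
  mul_nonneg (Real.rpow_nonneg (by have := x.i.hη.le; positivity) _) (cutHZd_nonneg x.i.hη.le β len (ζ u))

/-- ★★ **THE FIRST (3.43) MEMBER AT THE GENUINE READINGS, SUMMED**: (3.43) for `ζ·∇_{U,ν}G(U₀)` read off `B9.Ineq343_345 (GAZdOfOps …)` + the two Lemma-2.1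
letters with block factor `a(u) = (L^{j_u}η)^{1−β}·cutHZd(ζ_u)` ⟹ for every `f` on the class with `ω(π y)‖f(y)‖ ≤ M`, every block `u`, components `ν, μ` and
admissible pair `p`: `ω′(u)·hquot(ζ_u·∇_{U,ν}G(U₀)f̃)_μ(p) ≤ max{0, Bβ β}·R·S·M` — ANY cut-off family supported blockwise in `Δ̃(u)`; `len ≥ 1` on admissible
displacements (e.g. `l1Len`, `euclidLen`). [cite: Balaban1985BackgroundPropagators, (3.43) p.398 + p.398 l.17–20, Thm 3.3 p.399; Balaban1984PropagatorsII, Lemma 2.1 (2.60)–(2.61) p.234; Balaban1985RegularSpaces, (1.36) p.82, (1.59) p.86, (1.62) p.87] -/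
theorem weight_mul_hquot_cut_gradGop_le_of_ineq343 {x : MemberZd d L} [Fintype (BSite L x)] {ops : OpsZd d 𝔸} {U : CfgZd d 𝔸}
    {Bβ Bε : ℝ → ℝ} {Bεβ : ℝ → ℝ → ℝ} {δ₀ β : ℝ} (h345 : B9.Ineq343_345 (GAZdOfOps 𝔸 L len x ops) Bβ Bε Bεβ δ₀ U)
    (hβ0 : 0 ≤ β) (hβ1 : β < 1) (hlen : ∀ v : Site d, 0 < len v → 1 ≤ len v)
    (hlin : ∀ (c : ℝ) (A B : Site d → Fin d → 𝔸), ops.Gop U.1 (c • A + B) = c • ops.Gop U.1 A + ops.Gop U.1 B)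
    (ζ : BSite L x → Site d → ℝ) (hζ : ∀ (u : BSite L x) (z : Site d), ζ u z ≠ 0 → z ∈ blockTZd L u.1.1 u.1.2)
    {P : Site d × Fin d → Prop} (π : {b : Site d × Fin d // P b} → BSite L x)
    (hπ : ∀ b, b.1.1 ∈ blockZd L (π b).1.1 (π b).1.2)
    {κ₂ R S : ℝ} (hR : 0 ≤ R) {ω ω' : BSite L x → ℝ} (hω : ∀ v, 0 < ω v) (hω' : ∀ u, 0 ≤ ω' u)
    (hex : ∀ u v : BSite L x,
      ω' u * (((L : ℝ) ^ u.1.1 * x.i.η) ^ (1 - β) * cutHZd x.i.η β len (ζ u)) ≤ R * Real.exp (κ₂ * distZd L x u v) * ω v)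
    (hS : ∀ u : BSite L x, ∑ v, Real.exp (-((δ₀ - κ₂) * distZd L x u v)) ≤ S)
    (ν : Fin d) (f : {b : Site d × Fin d // P b} → 𝔸) {M : ℝ} (hM : 0 ≤ M) (hMf : ∀ y, ω (π y) * ‖f y‖ ≤ M)
    (u : BSite L x) (μ : Fin d) {p : Site d × Site d} (hp : p ∈ AdmPair x.i.η len) :
    ω' u * hquot x.i.η β len U.1 (fun z => cutMulZd (ζ u) (cdBZd x.i.η U.1 ν (ops.Gop U.1 (extZd P f))) z μ) p ≤
      max 0 (Bβ β) * R * S * M :=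
  weight_mul_hquot_cut_le_of_local U β (fun J => cdBZd x.i.η U.1 ν (ops.Gop U.1 J)) (comp_linear (cdBZd_linear x.i.η U.1 ν) hlin) ζ
    (le_max_left 0 (Bβ β)) (blockFactor_nonneg x β ζ)
    (fun u' v J hJ μ' p' hp' => locHolder_grad_of_ineq343 h345 hβ0 hβ1 hlen ζ hζ ν u' v J hJ μ' p' hp')
    π hπ hR hω hω' hex hS f hM hMf u μ hp

/-- ★★ **THE SECOND (3.43) MEMBER AT THE GENUINE READINGS, SUMMED**: the same for `ζ·G(U₀)∇*_{U,ν}` (the input-side letter).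
[cite: Balaban1985BackgroundPropagators, (3.43) p.398 + p.398 l.17–20, Thm 3.3 p.399; Balaban1984PropagatorsII, Lemma 2.1 (2.60)–(2.61) p.234] -/
theorem weight_mul_hquot_cut_gopDiv_le_of_ineq343 {x : MemberZd d L} [Fintype (BSite L x)] {ops : OpsZd d 𝔸} {U : CfgZd d 𝔸}
    {Bβ Bε : ℝ → ℝ} {Bεβ : ℝ → ℝ → ℝ} {δ₀ β : ℝ} (h345 : B9.Ineq343_345 (GAZdOfOps 𝔸 L len x ops) Bβ Bε Bεβ δ₀ U)
    (hβ0 : 0 ≤ β) (hβ1 : β < 1) (hlen : ∀ v : Site d, 0 < len v → 1 ≤ len v)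
    (hlin : ∀ (c : ℝ) (A B : Site d → Fin d → 𝔸), ops.Gop U.1 (c • A + B) = c • ops.Gop U.1 A + ops.Gop U.1 B)
    (ζ : BSite L x → Site d → ℝ) (hζ : ∀ (u : BSite L x) (z : Site d), ζ u z ≠ 0 → z ∈ blockTZd L u.1.1 u.1.2)
    {P : Site d × Fin d → Prop} (π : {b : Site d × Fin d // P b} → BSite L x)
    (hπ : ∀ b, b.1.1 ∈ blockZd L (π b).1.1 (π b).1.2)
    {κ₂ R S : ℝ} (hR : 0 ≤ R) {ω ω' : BSite L x → ℝ} (hω : ∀ v, 0 < ω v) (hω' : ∀ u, 0 ≤ ω' u)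
    (hex : ∀ u v : BSite L x,
      ω' u * (((L : ℝ) ^ u.1.1 * x.i.η) ^ (1 - β) * cutHZd x.i.η β len (ζ u)) ≤ R * Real.exp (κ₂ * distZd L x u v) * ω v)
    (hS : ∀ u : BSite L x, ∑ v, Real.exp (-((δ₀ - κ₂) * distZd L x u v)) ≤ S)
    (ν : Fin d) (f : {b : Site d × Fin d // P b} → 𝔸) {M : ℝ} (hM : 0 ≤ M) (hMf : ∀ y, ω (π y) * ‖f y‖ ≤ M)
    (u : BSite L x) (μ : Fin d) {p : Site d × Site d} (hp : p ∈ AdmPair x.i.η len) :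
    ω' u * hquot x.i.η β len U.1 (fun z => cutMulZd (ζ u) (ops.Gop U.1 (cdsBZd x.i.η U.1 ν (extZd P f))) z μ) p ≤
      max 0 (Bβ β) * R * S * M :=
  weight_mul_hquot_cut_le_of_local U β (fun J => ops.Gop U.1 (cdsBZd x.i.η U.1 ν J)) (comp_linear hlin (cdsBZd_linear x.i.η U.1 ν)) ζ
    (le_max_left 0 (Bβ β)) (blockFactor_nonneg x β ζ)
    (fun u' v J hJ μ' p' hp' => locHolder_div_of_ineq343 h345 hβ0 hβ1 hlen ζ hζ ν u' v J hJ μ' p' hp')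
    π hπ hR hω hω' hex hS f hM hMf u μ hp

/-- ★★ **NEAR PAIRS — THE INTEGRAND OF `HolderAtδ`**: where the cut-off of the output block is `1` at both points of the pair (`ζ_u(x) = ζ_u(x′) = 1`: `x ∈ Δ(u)`
and `x′` in the core of `Δ̃(u)`), the bound of `weight_mul_hquot_cut_gradGop_le_of_ineq343` holds for the BARE quotient of `∇_{U,ν}G(U₀)f̃` in the spelling of
`B9SupplySockB9P3ZdAt.HolderAt` (`covDerivFwd η U ν (fun z => G(U)J z μ)`): `ω′(u)·|x′−x|^{−β}|R(U(Γ_{x,x′}))(∇_νGf̃)_μ(x′) − (∇_νGf̃)_μ(x)| ≤ max{0,Bβ β}·R·S·M`.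
[cite: Balaban1985BackgroundPropagators, (3.43) p.398, (3.40) p.397, Thm 3.3 p.399; Balaban1985RegularSpaces, Prop. 3 p.87, (1.36) p.82, (1.59) p.86; Balaban1984PropagatorsII, Lemma 2.1 p.234] -/
theorem weight_mul_hquot_gradGop_le_of_ineq343 {x : MemberZd d L} [Fintype (BSite L x)] {ops : OpsZd d 𝔸} {U : CfgZd d 𝔸}
    {Bβ Bε : ℝ → ℝ} {Bεβ : ℝ → ℝ → ℝ} {δ₀ β : ℝ} (h345 : B9.Ineq343_345 (GAZdOfOps 𝔸 L len x ops) Bβ Bε Bεβ δ₀ U)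
    (hβ0 : 0 ≤ β) (hβ1 : β < 1) (hlen : ∀ v : Site d, 0 < len v → 1 ≤ len v)
    (hlin : ∀ (c : ℝ) (A B : Site d → Fin d → 𝔸), ops.Gop U.1 (c • A + B) = c • ops.Gop U.1 A + ops.Gop U.1 B)
    (ζ : BSite L x → Site d → ℝ) (hζ : ∀ (u : BSite L x) (z : Site d), ζ u z ≠ 0 → z ∈ blockTZd L u.1.1 u.1.2)
    {P : Site d × Fin d → Prop} (π : {b : Site d × Fin d // P b} → BSite L x)
    (hπ : ∀ b, b.1.1 ∈ blockZd L (π b).1.1 (π b).1.2)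
    {κ₂ R S : ℝ} (hR : 0 ≤ R) {ω ω' : BSite L x → ℝ} (hω : ∀ v, 0 < ω v) (hω' : ∀ u, 0 ≤ ω' u)
    (hex : ∀ u v : BSite L x,
      ω' u * (((L : ℝ) ^ u.1.1 * x.i.η) ^ (1 - β) * cutHZd x.i.η β len (ζ u)) ≤ R * Real.exp (κ₂ * distZd L x u v) * ω v)
    (hS : ∀ u : BSite L x, ∑ v, Real.exp (-((δ₀ - κ₂) * distZd L x u v)) ≤ S)
    (ν : Fin d) (f : {b : Site d × Fin d // P b} → 𝔸) {M : ℝ} (hM : 0 ≤ M) (hMf : ∀ y, ω (π y) * ‖f y‖ ≤ M)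
    (u : BSite L x) (μ : Fin d) {p : Site d × Site d} (hp : p ∈ AdmPair x.i.η len) (h1 : ζ u p.1 = 1) (h2 : ζ u p.2 = 1) :
    ω' u * hquot x.i.η β len U.1 (covDerivFwd x.i.η U.1 ν (fun z => ops.Gop U.1 (extZd P f) z μ)) p ≤ max 0 (Bβ β) * R * S * M := by
  have h := weight_mul_hquot_cut_gradGop_le_of_ineq343 h345 hβ0 hβ1 hlen hlin ζ hζ π hπ hR hω hω' hex hS ν f hM hMf u μ hp
  rw [hquot_cutMulZd_of_eq_one U.1 (ζ u) _ μ h1 h2] at h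
  exact h

end Main

/-! ## §4 Far pairs: the two endpoint values and the n = 1 sup entry -/

section Far

variable {𝔸 : Type} [CStarAlgebra 𝔸] [Nontrivial 𝔸] {L : ℕ} {len : Site d → ℝ}

omit [Nontrivial 𝔸] in
/-- **the weight arithmetic of a far pair**: `0 < t`, `0 < c`, `0 ≤ β`, `c·t ≤ s` ⟹ `t^{2+β}∕s^β ≤ c^{−β}·t²` (the Hölder weight `(Lʲη)^{2+β}` against a pair
of length `≥ c·Lʲη` leaves the sup weight `(Lʲη)²`). [cite: Balaban1985BackgroundPropagators, (3.41) p.397, (3.47) p.398 (bookkeeping)] -/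
theorem rpow_weight_far {t c s β : ℝ} (ht : 0 < t) (hc : 0 < c) (hβ : 0 ≤ β) (hs : c * t ≤ s) :
    t ^ (2 + β) / s ^ β ≤ c ^ (-β) * t ^ (2 : ℝ) := by
  have hct : 0 < c * t := mul_pos hc ht
  have hs0 : 0 < s := lt_of_lt_of_le hct hs
  have h1 : t ^ (2 + β) = t ^ (2 : ℝ) * t ^ β := Real.rpow_add ht 2 β
  have h2 : (c * t) ^ β ≤ s ^ β := Real.rpow_le_rpow hct.le hs hβ
  have h3 : (c * t) ^ β = c ^ β * t ^ β := Real.mul_rpow hc.le ht.le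
  have hcβ : 0 < c ^ β := Real.rpow_pos_of_pos hc β
  have htβ : 0 < t ^ β := Real.rpow_pos_of_pos ht β
  rw [h1, div_le_iff₀ (Real.rpow_pos_of_pos hs0 β), Real.rpow_neg hc.le]
  calc t ^ (2 : ℝ) * t ^ β = (c ^ β)⁻¹ * t ^ (2 : ℝ) * (c ^ β * t ^ β) := by field_simp
    _ ≤ (c ^ β)⁻¹ * t ^ (2 : ℝ) * s ^ β := by
        rw [← h3]
        exact mul_le_mul_of_nonneg_left h2 (mul_nonneg (inv_nonneg.2 hcβ.le) (Real.rpow_nonneg ht.le _))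

/-- ★ **FAR PAIRS, LETTER LEVEL**: for a unitary background, `0 ≤ β`, a pair with `|x′−x| = η·len ≥ c·Lʲη` (`c > 0`): `(Lʲη)^{2+β}·hquot F (x,x′) ≤
c^{−β}·((Lʲη)²‖F x‖ + (Lʲη)²‖F x′‖)` — in the weights of `B8ScaledSupNorm` (`weight L η (−(2+β)) j`, `weight L η (−2) j`).
[cite: Balaban1985BackgroundPropagators, (3.40)–(3.41) p.397, (3.47) p.398; Balaban1985RegularSpaces, (1.36) p.82, (1.59) p.86] -/
theorem weight_mul_hquot_le_of_far {x : MemberZd d L} (hL : 1 ≤ L) (U : CfgZd d 𝔸) {β : ℝ} (hβ : 0 ≤ β) (F : Site d → 𝔸)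
    {p : Site d × Site d} (hp : p ∈ AdmPair x.i.η len) (j : ℕ) {c : ℝ} (hc : 0 < c)
    (hfar : c * ((L : ℝ) ^ j * x.i.η) ≤ x.i.η * len (p.2 - p.1)) :
    weight L x.i.η (-(2 + β)) j * hquot x.i.η β len U.1 F p ≤
      c ^ (-β) * (weight L x.i.η (-(2 : ℝ)) j * ‖F p.1‖ + weight L x.i.η (-(2 : ℝ)) j * ‖F p.2‖) := by
  have hη : 0 < x.i.η := x.i.hη
  have ht : 0 < (L : ℝ) ^ j * x.i.η := B8ScaledSupNorm.scale_pos hL hη j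
  have hU1 : ∀ y κ, U.1 y κ ∈ U1 𝔸 := fun y κ => unitaryUnits_le_U1 (U.2 y κ)
  have hw : weight L x.i.η (-(2 + β)) j = ((L : ℝ) ^ j * x.i.η) ^ (2 + β) := by rw [B8ScaledSupNorm.weight, neg_neg]
  have hw2 : weight L x.i.η (-(2 : ℝ)) j = ((L : ℝ) ^ j * x.i.η) ^ (2 : ℝ) := by rw [B8ScaledSupNorm.weight, neg_neg]
  have hq := hquot_le_norm_add_div (β := β) hη.le hU1 F hp
  have hnn : 0 ≤ ‖F p.1‖ + ‖F p.2‖ := add_nonneg (norm_nonneg _) (norm_nonneg _)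
  have hfar' := rpow_weight_far ht hc hβ hfar
  rw [hw, hw2]
  calc ((L : ℝ) ^ j * x.i.η) ^ (2 + β) * hquot x.i.η β len U.1 F p
      ≤ ((L : ℝ) ^ j * x.i.η) ^ (2 + β) * ((‖F p.1‖ + ‖F p.2‖) / (x.i.η * len (p.2 - p.1)) ^ β) :=
        mul_le_mul_of_nonneg_left hq (Real.rpow_nonneg ht.le _)
    _ = ((L : ℝ) ^ j * x.i.η) ^ (2 + β) / (x.i.η * len (p.2 - p.1)) ^ β * (‖F p.1‖ + ‖F p.2‖) := by ring
    _ ≤ c ^ (-β) * ((L : ℝ) ^ j * x.i.η) ^ (2 : ℝ) * (‖F p.1‖ + ‖F p.2‖) := mul_le_mul_of_nonneg_right hfar' hnn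
    _ = c ^ (-β) * (((L : ℝ) ^ j * x.i.η) ^ (2 : ℝ) * ‖F p.1‖ + ((L : ℝ) ^ j * x.i.η) ^ (2 : ℝ) * ‖F p.2‖) := by ring

/-- ★ **FAR PAIRS FROM THE n = 1 SUP ENTRY**: for the site function `z ↦ (∇_{U,ν}Ψ)_μ(z)` of a bond field `Ψ` (`Ψ = G(U₀)J`: the integrand of `HolderAt`), a far
pair (`|x′−x| ≥ c·Lʲη`) BOTH OF WHOSE ENDPOINT BONDS `⟨x, x+e_μ⟩`, `⟨x′, x′+e_μ⟩` are sides of plaquettes touching `Ω_j` (`j ≤ m`), and a bounded `(−2)`-family: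
`(Lʲη)^{2+β}·hquot (x,x′) ≤ 2c^{−β}·|∇_UΨ|₍₋₂₎` — the `glob 1` reading of (3.47) ∕ the second line of B8 (1.59) (`DictAt`).  The second endpoint's membership
`hx'` is the clause the first-point class of `HolderAt` does not provide (LOCATED (L-H1)). [cite: Balaban1985BackgroundPropagators, (3.47) p.398, (3.40)–(3.41) p.397; Balaban1985RegularSpaces, (1.59) p.86, (1.36) p.82] -/
theorem weight_mul_hquot_le_msup_of_far {x : MemberZd d L} (hL : 1 ≤ L) (U : CfgZd d 𝔸) {β : ℝ} (hβ : 0 ≤ β)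
    (Ψ : Site d → Fin d → 𝔸) {m : ℕ}
    (hBdd : Bdd L m x.i.η (-(2 : ℝ)) (fun j (t : Fin d × Fin d × Site d) => SideTouches (x.i.Ω j) t.2.2 t.2.1)
      (fun t => covDerivFwd x.i.η U.1 t.1 (fun z => Ψ z t.2.1) t.2.2))
    (ν μ : Fin d) {p : Site d × Site d} (hp : p ∈ AdmPair x.i.η len) {j : ℕ} (hj : j ≤ m)
    (hx : SideTouches (x.i.Ω j) p.1 μ) (hx' : SideTouches (x.i.Ω j) p.2 μ) {c : ℝ} (hc : 0 < c)
    (hfar : c * ((L : ℝ) ^ j * x.i.η) ≤ x.i.η * len (p.2 - p.1)) :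
    weight L x.i.η (-(2 + β)) j * hquot x.i.η β len U.1 (covDerivFwd x.i.η U.1 ν (fun z => Ψ z μ)) p ≤
      2 * c ^ (-β) * msup L m x.i.η (-(2 : ℝ)) (fun j (t : Fin d × Fin d × Site d) => SideTouches (x.i.Ω j) t.2.2 t.2.1)
        (fun t => covDerivFwd x.i.η U.1 t.1 (fun z => Ψ z t.2.1) t.2.2) := by
  have h := weight_mul_hquot_le_of_far hL U hβ (covDerivFwd x.i.η U.1 ν (fun z => Ψ z μ)) hp j hc hfar
  have h1 : weight L x.i.η (-(2 : ℝ)) j * ‖covDerivFwd x.i.η U.1 ν (fun z => Ψ z μ) p.1‖ ≤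
      msup L m x.i.η (-(2 : ℝ)) (fun j (t : Fin d × Fin d × Site d) => SideTouches (x.i.Ω j) t.2.2 t.2.1)
        (fun t => covDerivFwd x.i.η U.1 t.1 (fun z => Ψ z t.2.1) t.2.2) :=
    weight_mul_norm_le_msup hBdd hj (i := (ν, μ, p.1)) hx
  have h2 : weight L x.i.η (-(2 : ℝ)) j * ‖covDerivFwd x.i.η U.1 ν (fun z => Ψ z μ) p.2‖ ≤
      msup L m x.i.η (-(2 : ℝ)) (fun j (t : Fin d × Fin d × Site d) => SideTouches (x.i.Ω j) t.2.2 t.2.1)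
        (fun t => covDerivFwd x.i.η U.1 t.1 (fun z => Ψ z t.2.1) t.2.2) :=
    weight_mul_norm_le_msup hBdd hj (i := (ν, μ, p.2)) hx'
  have hcβ : 0 ≤ c ^ (-β) := Real.rpow_nonneg hc.le _
  calc _ ≤ c ^ (-β) * (weight L x.i.η (-(2 : ℝ)) j * ‖covDerivFwd x.i.η U.1 ν (fun z => Ψ z μ) p.1‖ +
        weight L x.i.η (-(2 : ℝ)) j * ‖covDerivFwd x.i.η U.1 ν (fun z => Ψ z μ) p.2‖) := h
    _ ≤ c ^ (-β) * (msup L m x.i.η (-(2 : ℝ)) (fun j (t : Fin d × Fin d × Site d) => SideTouches (x.i.Ω j) t.2.2 t.2.1)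
        (fun t => covDerivFwd x.i.η U.1 t.1 (fun z => Ψ z t.2.1) t.2.2) +
        msup L m x.i.η (-(2 : ℝ)) (fun j (t : Fin d × Fin d × Site d) => SideTouches (x.i.Ω j) t.2.2 t.2.1)
        (fun t => covDerivFwd x.i.η U.1 t.1 (fun z => Ψ z t.2.1) t.2.2)) := mul_le_mul_of_nonneg_left (add_le_add h1 h2) hcβ
    _ = _ := by ring

end Far

end Literature.MathematicalPhysics.QuantumFieldTheory.Balaban1983to89.B9Eq343HolderGlobalFromLocalZd

end
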